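import Literature.NumberTheory.EllipticCurves.HeegnerGeomStabilizedPointIdentitiesProofs
import Literature.NumberTheory.EllipticCurves.HeegnerGeomCoherentFamilyIdentityProofs
import HarnessLib

/-!
# The COHERENT PAIR `(C, F)` on the principal CM system with ALL its point identities
# (P1′)/(P1″)/(P2′) with a Lucas pair at the actual shift jumps, and (P3) with a `p`-adic-unit leading
# coefficient (CGLS 2022 Thm. 4.1.1 proof / Rem. 4.1.4; Howard 2004 §3.3; Perrin-Riou 1987 §3.3) — THEOREMS ONLY

Topic `NumberTheory/EllipticCurves` (complex multiplication / Heegner points); namespace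
`Literature.NumberTheory.EllipticCurves`. No definition, no named fact, no `sorry`. Cell `pub/bsd-print-x9`,
seat `bsd-line-x9-p1-w2` (stub worker; the PRESENTATION WRAPPER feeding the Heegner-module envelope of the
crux `PrintX9.HowardContainmentLightFramePinnedOfPrintSharp`, stub `stub_envelopeModulesSharp`).

WHY. The envelope theorems of the cell are stated for an ABSTRACT pair `(C, F)` of a CGLS `d(k)`-shifted
stabilised datum and a Howard family subject to point identities above the torsion depth `δ`:
the forward inclusion `ℋ_∞(F) ≤ Λκ_∞(C)` (`heegnerModule_le_stabilizedHeegnerModule_of_coherent`,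
`HeegnerEnvelopeUniversalNormProofs`) takes
(P1′) `v_{j+1} = A_{n_j} • u_j + B_{n_j} • v_j`, (P1″) `v_{j+1}` is `K_j`-rational,
(P2′) `Σ_{i<p} γ^{p^j i} • u_{j+1} = A_{n_j+1} • u_j + B_{n_j+1} • v_j` for an integer Lucas pair
`A₀ = 1, A₁ = a_p, B₀ = 0, B₁ = −1, X_{m+2} = a_p X_{m+1} − p X_m` and jumps `n_j`, and
(P3) `z_j = a • u_j + b • v_j`; the reverse inclusion `ω_δ • Λκ_∞(C) ≤ ℋ_∞(F)` takes (P3) with `p ∤ a`,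
(P1′) in `∃`-form and (P1″) at `j = δ`. This file DISCHARGES all of them AT ONCE for ONE pair `(C, F)` built on
the tree's principal system (`exists_principalSystem`: `x_j` over `φ(x(p^j))`, fixed by `Gal(K̄/K[p^j])`) by the
constructors `exists_stabilizedHeegnerData_of_system` / `exists_heegnerFamily_of_system` — with the given
parametrisation datum `Dt` and orientation `β` for BOTH — from ONLY: `K` imaginary quadratic Heegner for
`N_E`, `p ∤ N_E` with `p ∤ a_p`, the tower containment `K_k ⊆ K[p^{k+1}]` (clause 1 of the cell's
`AnticyclotomicTowerSharp`; NO second clause, NO pin `d(k) = k − δ + 1`), `[K[p] : K[1]] = p − 1`, and a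
topological generator `γ` of `Gal(K_∞/K)`. The jumps are the ACTUAL ones, `n_j := d(j+1) − 1 − d(j) ≥ 0`
(`ringClassSubgroup_pred_le_layerSubgroup` + minimality of `d(j)`), so nothing about their value is claimed.

* §1 `exists_int_lucasPair` — integer Lucas pairs exist (plumbing).
* §2 `CastellaGrossiLeeSkinner2022.StabilizedHeegnerData.d_le_d_succ_sub_one` — `d(j) ≤ d(j+1) − 1` above `δ`.
* §3 **`exists_coherentPair`** — the package: `∃ C F A B ns`, `C.Dt = Dt = F.Dt`, `C.β = β = F.β`, Lucas
  clauses, (P1′) for `j > δ`, (P1″) for `j ≥ δ` (so both the forward's `hvfix` and the reverse's `hvδ`),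
  (P2′) for `j > δ`, (P3♯) `∃ a b, p ∤ a ∧ z_j = a • u_j + b • v_j` for `j > δ`; and the `∃`-weakening
  `exists_coherentPair_exists_form` of (P1′) used by the reverse consumer.
HONEST FRAMING: Galois bookkeeping over the tree's proved distribution relations
(`sum_transversal_smul_pred_eq_lucas_of_layer_succ`, `smul_sum_transversal_smul_pred_eq_of_layer_succ`,
`sum_range_pow_smul_sum_transversal_smul_eq_lucas`, `HeegnerFamily.exists_z_eq_zsmul_u_add_zsmul_v_of_presentation`);
nothing on `L`-functions, Selmer groups or BSD is asserted; BSD is not proved by any of this.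

References: [CastellaGrossiLeeSkinner2022] Thm. 4.1.1 proof (`d(k)`, `P_k[n]`), Rem. 4.1.4
(arXiv:2008.02571v2 p. 22); [Howard2004HeegnerKolyvagin] §2.7, §3.3; [PerrinRiou1987BSMF] §1, §3.3;
[Cox2013] Thm. 7.24, Cor. 7.28.
-/

set_option autoImplicit false

noncomputable section

open scoped Classical

namespace Literature.NumberTheory.EllipticCurves

open WeierstrassCurve RingClassField ModularForms

variable {K : Type} [Field K] [NumberField K]

/-! ## §1 Integer Lucas pairs -/

/-- **Integer solutions of the two-term recurrence with any initial values** (`X₀, X₁` given,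
`X_{n+2} = a X_{n+1} − q X_n`), via the pair-valued recursion `(X_n, X_{n+1})`. [folklore] -/
private theorem exists_int_lucasSeq (a q x₀ x₁ : ℤ) :
    ∃ X : ℕ → ℤ, X 0 = x₀ ∧ X 1 = x₁ ∧ ∀ n, X (n + 2) = a * X (n + 1) - q * X n := by
  let G : ℕ → ℤ × ℤ := fun n ↦ Nat.rec (x₀, x₁) (fun _ y ↦ (y.2, a * y.2 - q * y.1)) n
  have hG : ∀ n, G (n + 1) = ((G n).2, a * (G n).2 - q * (G n).1) := fun n ↦ rfl
  refine ⟨fun n ↦ (G n).1, rfl, ?_, fun n ↦ ?_⟩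
  · show (G (0 + 1)).1 = x₁
    rw [hG 0]
    rfl
  · show (G (n + 1 + 1)).1 = a * (G (n + 1)).1 - q * (G n).1
    rw [hG (n + 1), hG n]

/-- **An integer Lucas pair for `x² − a_p x + p`**: `A₀ = 1, A₁ = a_p`, `B₀ = 0, B₁ = −1`, both with
`X_{n+2} = a_p X_{n+1} − p X_n` (the coefficients of the iterated vertical distribution relations).
[cite: PerrinRiou1987BSMF, §3.3 (relations de distribution)] [cite: CastellaGrossiLeeSkinner2022, Rem. 4.1.4] -/
theorem exists_int_lucasPair (a : ℤ) (q : ℕ) :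
    ∃ A B : ℕ → ℤ, (A 0 = 1 ∧ A 1 = a ∧ ∀ n, A (n + 2) = a * A (n + 1) - q * A n) ∧
      (B 0 = 0 ∧ B 1 = -1 ∧ ∀ n, B (n + 2) = a * B (n + 1) - q * B n) := by
  obtain ⟨A, hA0, hA1, hA⟩ := exists_int_lucasSeq a q 1 a
  obtain ⟨B, hB0, hB1, hB⟩ := exists_int_lucasSeq a q 0 (-1)
  exact ⟨A, B, ⟨hA0, hA1, hA⟩, ⟨hB0, hB1, hB⟩⟩

/-! ## §2 The shift never jumps down: `d(j) ≤ d(j+1) − 1` above the torsion depth -/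

namespace CastellaGrossiLeeSkinner2022.StabilizedHeegnerData

variable {N : ℕ} [NeZero N] {W : WeierstrassCurve ℚ} {p : ℕ} [Fact p.Prime] {κ : ZpExtension K p}
  {jbar : AlgebraicClosure K →+* ℂ} (C : CastellaGrossiLeeSkinner2022.StabilizedHeegnerData N W K κ jbar)

/-- **`d(j) ≤ d(j+1) − 1` for `j ≥ δ`** (CGLS's minimal shifts: `K_j ⊆ K[p^{d(j+1)−1}]` by
`ringClassSubgroup_pred_le_layerSubgroup` — `K_{j+1}·K[p^{d(j+1)−1}] = K[p^{d(j+1)}]` read one layer down —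
and the minimality of `d(j)`), for `K` imaginary quadratic with `[K[p] : K[1]] = p − 1` (so `d(j+1) ≥ 2`).
[cite: CastellaGrossiLeeSkinner2022, Thm. 4.1.1 proof (d(k) = min {d : K_k ⊂ K[p^d]})] [cite: Cox2013, Cor. 7.28] -/
theorem d_le_d_succ_sub_one (hK : IsImaginaryQuadratic K)
    (hcardp : Nat.card (ringClassGalOver (jbar.comp (algebraMap K (AlgebraicClosure K))) p 1) = p - 1)
    {j : ℕ} (hj : C.depth ≤ j) : C.d j ≤ C.d (j + 1) - 1 := by
  have hd₁ : 2 ≤ C.d (j + 1) := C.two_le_d hK hcardp (Nat.lt_succ_of_le hj)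
  have hnot₁ : ¬ ringClassSubgroup K (p ^ (C.d (j + 1) - 1)) jbar ≤ κ.layerSubgroup (j + 1) :=
    C.d_min (j + 1) _ (by omega)
  by_contra h
  exact C.d_min j _ (not_le.mp h)
    (ringClassSubgroup_pred_le_layerSubgroup hK jbar κ hd₁ (C.layer_le (j + 1)) hnot₁)

end CastellaGrossiLeeSkinner2022.StabilizedHeegnerData

/-! ## §3 The coherent pair with all its point identities -/

/-- **THE COHERENT PAIR PACKAGE.** For `E = W/ℚ` at its own level `N_E`, `K` imaginary quadratic Heegner for
`N_E`, an orientation `β` (`4N_E ∣ β² − d_K`), a prime `p ∤ N_E` with `p ∤ a_p`, a `ℤ_p`-extension `κ` with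
topological generator `γ` whose layers satisfy `K_k ⊆ K[p^{k+1}]`, and `[K[p] : K[1]] = p − 1`: there are a CGLS
`d(k)`-shifted stabilised datum `C` and a Howard family `F`, BOTH with parametrisation datum `Dt` and
orientation `β`, an integer Lucas pair `(A, B)` (`A₀ = 1, A₁ = a_p, B₀ = 0, B₁ = −1`,
`X_{m+2} = a_p X_{m+1} − p X_m`) and jumps `ns : ℕ → ℕ` (in fact `ns j = d(j+1) − 1 − d(j)`) such that, with
`δ = C.depth`:
(P1′) `v_{j+1} = A_{ns j} • u_j + B_{ns j} • v_j` for `j > δ`;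
(P1″) `σ • v_{j+1} = v_{j+1}` for every `σ ∈ Gal(K̄/K_j)` and every `j ≥ δ`;
(P2′) `Σ_{i<p} γ^{p^j i} • u_{j+1} = A_{ns j + 1} • u_j + B_{ns j + 1} • v_j` for `j > δ`;
(P3♯) `z_j = a • u_j + b • v_j` with `a, b ∈ ℤ`, `p ∤ a`, for `j > δ`.
All four are the tree's transversal-sum identities on ONE principal system `x_j` (`exists_principalSystem`)
read through the presentations OUTPUT by `exists_stabilizedHeegnerData_of_system` (`u_k = Σ_{A_k} a • x_{d(k)}`,
`v_k = Σ_{A_k} a • x_{d(k)−1}`) and `exists_heegnerFamily_of_system` (`z_j = Σ_{R_j} r • x_{j+1}`).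
[cite: CastellaGrossiLeeSkinner2022, Thm. 4.1.1 proof (d(k), P_k[n]) and Rem. 4.1.4 (arXiv:2008.02571v2 p. 22)]
[cite: Howard2004HeegnerKolyvagin, §3.3 (H_k and its norm generators)] [cite: PerrinRiou1987BSMF, §3.3 (relations de distribution)] -/
theorem exists_coherentPair {W : WeierstrassCurve ℚ} [W.IsElliptic] [W.IsGloballyMinimal]
    [NeZero (W.conductorNorm ℤ)] (hK : IsImaginaryQuadratic K)
    (hH : SatisfiesHeegnerHypothesis (W.conductorNorm ℤ) K)
    (Dt : ModularParametrizationData W (W.conductorNorm ℤ)) {β : ℤ}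
    (hβ : (4 * (W.conductorNorm ℤ : ℕ) : ℤ) ∣ β ^ 2 - NumberField.discr K)
    (jbar : AlgebraicClosure K →+* ℂ) {p : ℕ} [Fact p.Prime] (hpN : ¬ p ∣ W.conductorNorm ℤ)
    (hap : ¬ (p : ℤ) ∣ W.frobeniusTrace p) (κ : ZpExtension K p) {γ : Field.absoluteGaloisGroup K}
    (hγ : κ.IsTopGenerator γ)
    (hTw1 : ∀ k, ringClassSubgroup K (p ^ (k + 1)) jbar ≤ κ.layerSubgroup k)
    (hcardp : Nat.card (ringClassGalOver (jbar.comp (algebraMap K (AlgebraicClosure K))) p 1) = p - 1) :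
    ∃ (C : CastellaGrossiLeeSkinner2022.StabilizedHeegnerData (W.conductorNorm ℤ) W K κ jbar)
      (F : HeegnerFamily (W.conductorNorm ℤ) W K κ jbar) (A B : ℕ → ℤ) (ns : ℕ → ℕ),
      C.Dt = Dt ∧ F.Dt = Dt ∧ C.β = β ∧ F.β = β ∧
      (A 0 = 1 ∧ A 1 = W.frobeniusTrace p ∧
        ∀ m, A (m + 2) = W.frobeniusTrace p * A (m + 1) - p * A m) ∧
      (B 0 = 0 ∧ B 1 = -1 ∧ ∀ m, B (m + 2) = W.frobeniusTrace p * B (m + 1) - p * B m) ∧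
      (∀ j, C.depth < j → C.v (j + 1) = A (ns j) • C.u j + B (ns j) • C.v j) ∧
      (∀ j, C.depth ≤ j → ∀ σ ∈ κ.layerSubgroup j, σ • C.v (j + 1) = C.v (j + 1)) ∧
      (∀ j, C.depth < j →
        ∑ i ∈ Finset.range p, (γ ^ (p ^ j * i)) • C.u (j + 1) =
          A (ns j + 1) • C.u j + B (ns j + 1) • C.v j) ∧
      (∀ j, C.depth < j → ∃ a b : ℤ, ¬ (p : ℤ) ∣ a ∧ F.z j = a • C.u j + b • C.v j) := by
  have hp : p.Prime := Fact.out
  -- the principal system and the two structures presented on it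
  obtain ⟨x, P, hxP⟩ := exists_principalSystem hK hH Dt hβ jbar hp hpN
  have hx : ∀ j, complexPoint W jbar (x j) =
      heegnerPointComplexOfConductor Dt (NumberField.discr K) β (p ^ j) := fun j ↦ (hxP j).1
  have hP : ∀ j, WeierstrassCurve.Affine.Point.map (W' := W)
      (ringClassField K (jbar.comp (algebraMap K (AlgebraicClosure K))) (p ^ j)).subtype.toRatAlgHom (P j) =
      heegnerPointComplexOfConductor Dt (NumberField.discr K) β (p ^ j) := fun j ↦ (hxP j).2.1
  have hgeom : ∀ j, IsHeegnerGeomPoint (W.conductorNorm ℤ) W K Dt β (p ^ j) jbar (x j) :=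
    fun j ↦ (hxP j).2.2.1
  have hfix : ∀ j, ∀ σ ∈ ringClassSubgroup K (p ^ j) jbar, σ • x j = x j := fun j ↦ (hxP j).2.2.2
  obtain ⟨C, At, hCDt, hCβ, -, -, hAt, hu, hv⟩ :=
    exists_stabilizedHeegnerData_of_system hK Dt hβ jbar κ hTw1 hcardp hgeom hfix
  obtain ⟨F, -, R, hFDt, hFβ, -, -, hR, hz⟩ := exists_heegnerFamily_of_system Dt hβ jbar κ hgeom hfix
  obtain ⟨A, B, ⟨hA0, hA1, hA⟩, ⟨hB0, hB1, hB⟩⟩ := exists_int_lucasPair (W.frobeniusTrace p) p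
  -- bookkeeping on the shifts above the torsion depth
  have hd₁ : ∀ j, C.depth ≤ j → 2 ≤ C.d (j + 1) := fun j hj ↦
    C.two_le_d hK hcardp (Nat.lt_succ_of_le hj)
  have hnot₁ : ∀ j, C.depth ≤ j →
      ¬ ringClassSubgroup K (p ^ (C.d (j + 1) - 1)) jbar ≤ κ.layerSubgroup (j + 1) := fun j hj ↦
    C.d_min (j + 1) _ (by have := hd₁ j hj; omega)
  have hd₀ : ∀ j, C.depth < j → 1 ≤ C.d j := fun j hj ↦ by
    have := C.two_le_d hK hcardp hj; omega
  have hd₀₁ : ∀ j, C.depth ≤ j → C.d j ≤ C.d (j + 1) - 1 := fun j hj ↦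
    C.d_le_d_succ_sub_one hK hcardp hj
  refine ⟨C, F, A, B, fun j ↦ C.d (j + 1) - 1 - C.d j, hCDt, hFDt, hCβ, hFβ, ⟨hA0, hA1, hA⟩,
    ⟨hB0, hB1, hB⟩, fun j hj ↦ ?_, fun j hj σ hσ ↦ ?_, fun j hj ↦ ?_, fun j hj ↦ ?_⟩
  · -- (P1′)
    rw [hv (j + 1), hu j, hv j]
    exact sum_transversal_smul_pred_eq_lucas_of_layer_succ hK hH Dt hβ jbar hpN hx hP hfix κ A B hA0 hA1 hA
      hB0 hB1 hB (hd₁ j hj.le) (C.layer_le (j + 1)) (hnot₁ j hj.le) (hAt (j + 1)).1 (hAt (j + 1)).2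
      (hd₀ j hj) (hd₀₁ j hj.le) (C.layer_le j) (hAt j).1 (hAt j).2
  · -- (P1″)
    rw [hv (j + 1)]
    exact smul_sum_transversal_smul_pred_eq_of_layer_succ hK jbar hfix κ (hd₁ j hj) (C.layer_le (j + 1))
      (hnot₁ j hj) (hAt (j + 1)).1 (hAt (j + 1)).2 hσ
  · -- (P2′)
    have hns : C.d (j + 1) - C.d j = C.d (j + 1) - 1 - C.d j + 1 := by
      have := hd₀₁ j hj.le; have := hd₀ j hj; omega
    rw [hu (j + 1), hu j, hv j, ← hns]
    exact sum_range_pow_smul_sum_transversal_smul_eq_lucas hK hH Dt hβ jbar hpN hx hP hfix κ A B hA0 hA1 hA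
      hB0 hB1 hB hγ (hd₁ j hj.le) (C.layer_le (j + 1)) (hAt (j + 1)).1 (hAt (j + 1)).2 (hd₀ j hj)
      (hd₀₁ j hj.le) (C.layer_le j) (hAt j).1 (hAt j).2
  · -- (P3♯)
    exact F.exists_z_eq_zsmul_u_add_zsmul_v_of_presentation C hK hH Dt hβ hpN hap hTw1 hcardp hxP hAt hu hv
      hR hz hj

/-- **The coherent pair in the letters of the reverse envelope**: same package with (P1′) weakened to its
`∃ a b`-form and (P1″) specialised to `j = δ` (`v_{δ+1}` is `K_δ`-rational) — the hypotheses `hz`, `hv1`, `hvδ`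
of the cell's reverse inclusion `ω_δ • Λκ_∞(C) ≤ ℋ_∞(F)` — kept TOGETHER with the forward letters so that ONE
pair serves both inclusions. [cite: CastellaGrossiLeeSkinner2022, Rem. 4.1.4] [cite: Howard2004HeegnerKolyvagin, §3.3] -/
theorem exists_coherentPair_exists_form {W : WeierstrassCurve ℚ} [W.IsElliptic] [W.IsGloballyMinimal]
    [NeZero (W.conductorNorm ℤ)] (hK : IsImaginaryQuadratic K)
    (hH : SatisfiesHeegnerHypothesis (W.conductorNorm ℤ) K)
    (Dt : ModularParametrizationData W (W.conductorNorm ℤ)) {β : ℤ}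
    (hβ : (4 * (W.conductorNorm ℤ : ℕ) : ℤ) ∣ β ^ 2 - NumberField.discr K)
    (jbar : AlgebraicClosure K →+* ℂ) {p : ℕ} [Fact p.Prime] (hpN : ¬ p ∣ W.conductorNorm ℤ)
    (hap : ¬ (p : ℤ) ∣ W.frobeniusTrace p) (κ : ZpExtension K p) {γ : Field.absoluteGaloisGroup K}
    (hγ : κ.IsTopGenerator γ)
    (hTw1 : ∀ k, ringClassSubgroup K (p ^ (k + 1)) jbar ≤ κ.layerSubgroup k)
    (hcardp : Nat.card (ringClassGalOver (jbar.comp (algebraMap K (AlgebraicClosure K))) p 1) = p - 1) :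
    ∃ (C : CastellaGrossiLeeSkinner2022.StabilizedHeegnerData (W.conductorNorm ℤ) W K κ jbar)
      (F : HeegnerFamily (W.conductorNorm ℤ) W K κ jbar) (A B : ℕ → ℤ) (ns : ℕ → ℕ),
      C.Dt = Dt ∧ F.Dt = Dt ∧ C.β = β ∧ F.β = β ∧
      (A 0 = 1 ∧ A 1 = W.frobeniusTrace p ∧
        ∀ m, A (m + 2) = W.frobeniusTrace p * A (m + 1) - p * A m) ∧
      (B 0 = 0 ∧ B 1 = -1 ∧ ∀ m, B (m + 2) = W.frobeniusTrace p * B (m + 1) - p * B m) ∧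
      (∀ j, C.depth < j → C.v (j + 1) = A (ns j) • C.u j + B (ns j) • C.v j) ∧
      (∀ j, C.depth < j → ∀ σ ∈ κ.layerSubgroup j, σ • C.v (j + 1) = C.v (j + 1)) ∧
      (∀ j, C.depth < j →
        ∑ i ∈ Finset.range p, (γ ^ (p ^ j * i)) • C.u (j + 1) =
          A (ns j + 1) • C.u j + B (ns j + 1) • C.v j) ∧
      (∀ j, C.depth < j → ∃ a b : ℤ, ¬ (p : ℤ) ∣ a ∧ F.z j = a • C.u j + b • C.v j) ∧
      (∀ j, C.depth < j → ∃ a b : ℤ, F.z j = a • C.u j + b • C.v j) ∧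
      (∀ j, C.depth < j → ∃ a b : ℤ, C.v (j + 1) = a • C.u j + b • C.v j) ∧
      (∀ σ ∈ κ.layerSubgroup C.depth, σ • C.v (C.depth + 1) = C.v (C.depth + 1)) := by
  obtain ⟨C, F, A, B, ns, hCDt, hFDt, hCβ, hFβ, hAl, hBl, hv1, hvfix, hnorm, hz⟩ :=
    exists_coherentPair hK hH Dt hβ jbar hpN hap κ hγ hTw1 hcardp
  exact ⟨C, F, A, B, ns, hCDt, hFDt, hCβ, hFβ, hAl, hBl, hv1, fun j hj ↦ hvfix j hj.le, hnorm, hz,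
    fun j hj ↦ (hz j hj).imp fun a ⟨b, _, h⟩ ↦ ⟨b, h⟩, fun j hj ↦ ⟨A (ns j), B (ns j), hv1 j hj⟩,
    hvfix C.depth le_rfl⟩

end Literature.NumberTheory.EllipticCurves

end
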